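import Mathlib
import HarnessLib
import Summits.HubbardSuperconductivity.HubbardSuperconductivity.Theorems.KLProgrammeKLRegimeSplitBundleV12
import Summits.HubbardSuperconductivity.HubbardSuperconductivity.Theorems.KLProgrammeKLRegimeSplitFrameFnMin

/-!
# Route `KLProgramme` — crux K3 `KLRegimeTwoPointLimit` (stmt-HubbardSuperconductivity-19937): the GEN-5 bundle
# `klPredsV13` = V12 with the two-leg slot's PIECES de-interpolated (defect Δ23 / Δ-INTERP; cell gate-hubbard-kl, seat p2 g6;
# plan g12 RULING-DRAFT 2026-08-27T01:33:11Z (R1) (R-I-min) + AMENDMENT (R2′) 01:37:23Z «ADOPT p2's kit as the V13 two-leg text», XREAD OK)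

Δ23 (p2 g6 `HOME/p2-g6/DELTA-INTERP.md` 3b00c83bc71a69dc; plan g11 ruling STATUS l.1449, (H) l.1461; plan g12 l.1551 + (R2′)): the second
interpolation `klFrameExtG = symInterp L (…)` has no L-uniform sup-Fréchet certificate at the top certified derivative order, so the (E3a)/(E3a-MS)
tier-2 clauses on INTERPOLANT pieces cannot close; the repair keeps frames `K : TrigPolyC4v` (`FrameOK`, `frameDist`, `RenormalisedAtF`, the
split / engine slots, (E3d/e), (E3g), (E3f) BYTE-IDENTICAL) and states the two-leg piece clauses on the FUNCTION pieces
`klTwoLegPieceFn L M β U μ K.eval n` (`…SplitFrameFn` p479563) through the adapter kit `…SplitFrameFnMin` (p482731: `TwoLegStepT`,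
`TwoLegSizesMST`, `FrameLipschitzFnT`, `frameOKFn_eval_of_frameOK`); the model congruence `…SplitModelCongr` (p482281) and the lattice bridge
`…SplitFrameFnLatticeBridge` (p483097) show the MODEL sees exactly today's frames and pieces.

DEVIATIONS FROM `TwoLegStepV12` (complete list; everything else token-for-token):
(D1) the two-leg PIECES are functions — `onM (klTwoLegPieceFn L M β U μ K.eval n)` replaces `evalM (klTwoLegPieceG L M β U μ K n)` in
     (E3a)/(E3b)/(E3c)/(E3a-MS); by `klTwoLegPolyFn_eval` (p482281) the piece is `klFrameExtFn μ (klLocalPart … K ·)`-built, i.e. V12's profile (I-1)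
     with the (I-2) interpolant `symInterp L` REMOVED; at lattice momenta it equals the V12 piece (p483097);
(D2) (E3a) gains the leading conjunct `ContDiff ℝ 4 (onM piece)` (automatic for a trigonometric polynomial in V12, stated for a function;
     supplied generically by `contDiff_onM_klFrameExtFn`, k3c3-p1 p482190);
(D3) (E3a) tier-2's guard reads `FrameOKFn R U n μ K.eval`, implied by V12's `FrameOK R U n μ K` (`frameOKFn_eval_of_frameOK`, p482731) —
     the consumer direction is the only one used (`TwoLegStepT.norm_iteratedFDeriv_le_of_frameOK`); the supplier's obligation depends on the
     pieces' derivative BOUNDS only, never on their polynomiality;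
(D4) (E3a-MS): `∃ lp : ℕ → FrameFn` with the added conjunct `∀ m, IsSymmetricFrame (lp m) ∧ ContDiff ℝ 4 (onM (lp m))` (automatic in V12),
     numerals `twoLegBar` / `msBar` / `klMsKappa = 64` / `R.Gfr` unchanged (`TwoLegSizesMST … K n := TwoLegSizesMSFn … K.eval n`);
(D5) (E3c) = `FrameLipschitzFnT`: function pieces; comparison frame / guard `FrameOK R U (klTempScaleIdx β klE0) μ K′` / `hist` / `frameDist`
     = V12's (`frameDist` is already the sup over ℝ² of the frames' difference — the (E3c) twin of Δ23 is cured by it).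
UNCHANGED: `Preds`, GenericV4, GlueP4, `FrameOK`, `RenormalisedAtF`, `BetaSplitAtS2`, `EngineBoundsAtV8S`, `histV12` (the V13 history IS
`histV12` — the history has no two-leg conjunct; `histV13` below is a convenience alias only), (E3d/e) `TwoLegSlopes`, (E3g) `TwoLegAngularG`
(+ `angBar`), (E3f) `TwoLegVolumeRate`, `FinalTwoLegVolLimitEx`, every `∀ K : TrigPolyC4v` binder.  QUANTIFIER ORDER: `EngineP4`'s `∃ L₃ M₃`
before `∀ K` is untouched and sound for this slot — no V13 clause bounds an L-dependent interpolant of a K-dependent continuum symbol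
(plan g12 l.1551 (R6)).

Contents: `histV13` (alias of `histV12`), `TwoLegStepV13 … K n := TwoLegStepT histV12 … K n ∧ TwoLegSizesMST … K n ∧ TwoLegAngularG … K n ∧
TwoLegVolumeRate (histV12 ∧ TwoLegStepT histV12 ∧ TwoLegSizesMST ∧ TwoLegAngularG) Q β U μ K n` (= `TwoLegStepV12` with `TwoLegStepG ↦ TwoLegStepT`,
`TwoLegSizesMS ↦ TwoLegSizesMST`), `klPredsV13 : Preds` as a LITERAL (field-wise `rfl` to `klPredsV12` outside `twoLeg`, §2), and BundleV12 §4's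
bookkeeping one for one.  Children of gen 5: `EngineP4 | BetaSplitP | CountertermP2 | VolumeLimitP2 (FinalTwoLegVolLimitEx) | TwoPointAssemblyP3
(FinalTwoLegVolLimitEx)` on `klPredsV13 klWindowC`.  Definitions only; nothing is asserted about the model.
-/

noncomputable section

namespace Summit.HubbardSuperconductivity.HubbardSuperconductivity.Theorems.KLRegimeSplit

set_option linter.dupNamespace false -- summit = problem name (single-conjunct summit), D-0017

open Real Finset Literature.MathematicalPhysics.QuantumLattice Literature.Probability.LatticeModels
open Literature.MathematicalPhysics.QuantumLattice.FermiRG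
open Summit.HubbardSuperconductivity.HubbardSuperconductivity.Theorems.KLProgrammeLegKernels

/-! ## §1 The V13 history, two-leg slot and bundle -/

section Model

variable (L M : ℕ) [NeZero L] [NeZero M]

/-- **The history of the V13 bundle** — an ALIAS of `histV12` (`BetaSplitAtS2 ∧ RenormalisedAtF ∧ EngineBoundsAtV8S`): Δ23 does not touch the
split / renorm / engine slots. -/
abbrev histV13 (G : GeoConsts) (P : SplitConsts) (Q : EngConsts) (R : RenConsts) (β U μ : ℝ) : TrigPolyC4v → ℕ → Prop :=
  histV12 L M G P Q R β U μ

/-- **`TwoLegStepV13 … G P Q R K n`** := `TwoLegStepT histV12 ∧ TwoLegSizesMST ∧ TwoLegAngularG ∧ TwoLegVolumeRate (histV12 ∧ TwoLegStepT histV12 ∧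
TwoLegSizesMST ∧ TwoLegAngularG)` — V12's two-leg slot with (E3a)/(E3b)/(E3c)/(E3a-MS) stated on the FUNCTION pieces `klTwoLegPieceFn … K.eval`
(Δ23 (R-I-min)); (E3d/e) slopes, (E3g) angular regularity and (E3f) volume rate are V12's verbatim (they read the (I-1) local part only).
Same slot type as `Preds.twoLeg`. -/
def TwoLegStepV13 (G : GeoConsts) (P : SplitConsts) (Q : EngConsts) (R : RenConsts) (β U μ : ℝ) (K : TrigPolyC4v) (n : ℕ) :
    Prop :=
  TwoLegStepT L M (histV12 L M G P Q R β U μ) G P Q R β U μ K n ∧ TwoLegSizesMST L M G Q R β U μ K n ∧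
    TwoLegAngularG L M G Q R β U μ K n ∧
      TwoLegVolumeRate L M
        (fun L' M' _ _ K' j => histV12 L' M' G P Q R β U μ K' j ∧
          TwoLegStepT L' M' (histV12 L' M' G P Q R β U μ) G P Q R β U μ K' j ∧ TwoLegSizesMST L' M' G Q R β U μ K' j ∧
            TwoLegAngularG L' M' G Q R β U μ K' j)
        Q β U μ K n

end Model

/-- **`klPredsV13 : Preds`** — the LITERAL `{ frameOK := FrameOK, renorm := RenormalisedAtF, split := BetaSplitAtS2, engine := EngineBoundsAtV8S,
twoLeg := TwoLegStepV13 }` (field-wise `rfl` to `klPredsV12` outside `twoLeg`, §2).  Children of gen 5: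
`EngineP4 | BetaSplitP | CountertermP2 | VolumeLimitP2 (FinalTwoLegVolLimitEx) | TwoPointAssemblyP3 (FinalTwoLegVolLimitEx)` on `klPredsV13 klWindowC`;
BetaSplit / Assembly / glue close at birth by one-liners (their closers read only the split/engine slots / are universal in `Pr`). -/
def klPredsV13 : Preds where
  frameOK := FrameOK
  renorm := fun L M _ _ β U μ K R n => RenormalisedAtF L M β U μ K R n
  split := fun L M _ _ G P Q β U μ K n => BetaSplitAtS2 L M G P Q β U μ K n
  engine := fun L M _ _ G P Q β U μ K n => EngineBoundsAtV8S L M G P Q β U μ K n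
  twoLeg := fun L M _ _ G P Q R β U μ K n => TwoLegStepV13 L M G P Q R β U μ K n

/-! ## §2 Bookkeeping (`rfl`-level) -/

/-- V13's frame class IS V12's (`FrameOK`). -/
theorem klPredsV13_frameOK : klPredsV13.frameOK = klPredsV12.frameOK := rfl

/-- V13's renormalisation slot IS V12's. -/
theorem klPredsV13_renorm : klPredsV13.renorm = klPredsV12.renorm := rfl

/-- V13's split slot IS V12's. -/
theorem klPredsV13_split : klPredsV13.split = klPredsV12.split := rfl

/-- V13's engine slot IS V12's (`EngineBoundsAtV8S`). -/
theorem klPredsV13_engine : klPredsV13.engine = klPredsV12.engine := rfl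

/-- V13's engine slot, applied. -/
theorem klPredsV13_engine_apply (L M : ℕ) [NeZero L] [NeZero M] (G : GeoConsts) (P : SplitConsts) (Q : EngConsts) (β U μ : ℝ)
    (K : TrigPolyC4v) (n : ℕ) : klPredsV13.engine L M G P Q β U μ K n = EngineBoundsAtV8S L M G P Q β U μ K n := rfl

/-- V13's split slot, applied. -/
theorem klPredsV13_split_apply (L M : ℕ) [NeZero L] [NeZero M] (G : GeoConsts) (P : SplitConsts) (Q : EngConsts) (β U μ : ℝ)
    (K : TrigPolyC4v) (n : ℕ) : klPredsV13.split L M G P Q β U μ K n = BetaSplitAtS2 L M G P Q β U μ K n := rfl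

/-- V13's renormalisation slot, applied. -/
theorem klPredsV13_renorm_apply (L M : ℕ) [NeZero L] [NeZero M] (β U μ : ℝ) (K : TrigPolyC4v) (R : RenConsts) (n : ℕ) :
    klPredsV13.renorm L M β U μ K R n = RenormalisedAtF L M β U μ K R n := rfl

/-- V13's frame class is `FrameOK`. -/
theorem klPredsV13_frameOK_apply : klPredsV13.frameOK = FrameOK := rfl

/-- V13's two-leg slot is `TwoLegStepV13`. -/
theorem klPredsV13_twoLeg (L M : ℕ) [NeZero L] [NeZero M] (G : GeoConsts) (P : SplitConsts) (Q : EngConsts) (R : RenConsts)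
    (β U μ : ℝ) (K : TrigPolyC4v) (n : ℕ) :
    klPredsV13.twoLeg L M G P Q R β U μ K n = TwoLegStepV13 L M G P Q R β U μ K n := rfl

section Model

variable {L M : ℕ} [NeZero L] [NeZero M] {G : GeoConsts} {P : SplitConsts} {Q : EngConsts} {R : RenConsts} {β U μ : ℝ}
  {K : TrigPolyC4v} {n : ℕ}

/-- The «T» two-leg step (function pieces, today's class) is the first conjunct of the V13 slot. -/
theorem twoLegStepT_of_twoLegStepV13 (h : TwoLegStepV13 L M G P Q R β U μ K n) :
    TwoLegStepT L M (histV12 L M G P Q R β U μ) G P Q R β U μ K n := h.1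

/-- (E3a-MS-T) is the second conjunct. -/
theorem twoLegSizesMST_of_twoLegStepV13 (h : TwoLegStepV13 L M G P Q R β U μ K n) : TwoLegSizesMST L M G Q R β U μ K n := h.2.1

/-- (E3g) is the third conjunct (V12's text verbatim). -/
theorem twoLegAngularG_of_twoLegStepV13 (h : TwoLegStepV13 L M G P Q R β U μ K n) : TwoLegAngularG L M G Q R β U μ K n := h.2.2.1

/-- The volume-rate conjunct (E3f) with its V13 antecedent. -/
theorem twoLegVolumeRate_of_twoLegStepV13 (h : TwoLegStepV13 L M G P Q R β U μ K n) :
    TwoLegVolumeRate L M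
      (fun L' M' _ _ K' j => histV12 L' M' G P Q R β U μ K' j ∧
        TwoLegStepT L' M' (histV12 L' M' G P Q R β U μ) G P Q R β U μ K' j ∧ TwoLegSizesMST L' M' G Q R β U μ K' j ∧
          TwoLegAngularG L' M' G Q R β U μ K' j)
      Q β U μ K n := h.2.2.2

/-- `HistP klPredsV13` below `n` yields the V12 (= V13) history. -/
theorem histV12_of_histP_V13 (h : HistP klPredsV13 L M G P Q R β U μ K n) : ∀ j < n, histV12 L M G P Q R β U μ K j :=
  fun j hj => ⟨(h j hj).1, (h j hj).2.1, (h j hj).2.2.1⟩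

/-- `HistP klPredsV13` below `n` yields the full (E3f) antecedent of V13 at that volume. -/
theorem histRateV13_of_histP (h : HistP klPredsV13 L M G P Q R β U μ K n) :
    ∀ j < n, histV12 L M G P Q R β U μ K j ∧ TwoLegStepT L M (histV12 L M G P Q R β U μ) G P Q R β U μ K j ∧
      TwoLegSizesMST L M G Q R β U μ K j ∧ TwoLegAngularG L M G Q R β U μ K j := fun j hj =>
  ⟨⟨(h j hj).1, (h j hj).2.1, (h j hj).2.2.1⟩, (h j hj).2.2.2.1, (h j hj).2.2.2.2.1, (h j hj).2.2.2.2.2.1⟩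

/-- **V13's rate clause applies whenever the comparison volume carries the V13 history** (child 2's one-liner). -/
theorem twoLegVolumeRate_apply_of_V13 (h : TwoLegStepV13 L M G P Q R β U μ K n) (hM : Q.M0 β L ≤ M) {L' M' : ℕ} [NeZero L']
    [NeZero M'] (hL : L ≤ L') (hM' : Q.M0 β L' ≤ M') (hhist : HistP klPredsV13 L' M' G P Q R β U μ K n) (θ : ℝ) :
    |klLocalPart L M β U μ K n θ - klLocalPart L' M' β U μ K n θ| ≤ Q.CL β n / L :=
  h.2.2.2 hM L' M' hL hM' (histRateV13_of_histP hhist) θ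

/-- Tier-2 sizes of the function piece from TODAY's level-`n` admissibility (`frameOKFn_eval_of_frameOK` inside `TwoLegStepT`). -/
theorem norm_iteratedFDeriv_pieceFn_le_of_V13 (h : TwoLegStepV13 L M G P Q R β U μ K n) (hK : FrameOK R U n μ K) {j : ℕ} (hj : j ≤ 4)
    (q : Momentum) : ‖iteratedFDeriv ℝ j (onM (klTwoLegPieceFn L M β U μ K.eval n)) q‖ ≤ twoLegBar G Q U j n :=
  h.1.norm_iteratedFDeriv_le_of_frameOK hK hj q

end Model

end Summit.HubbardSuperconductivity.HubbardSuperconductivity.Theorems.KLRegimeSplit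

end
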